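import Summits.Ventures.LatticeQCDFlow.Scaling.DominatedStarRetunedConstants
import Summits.Ventures.LatticeQCDFlow.Scaling.RefreshBudgetFloor

/-!
HONEST FRAMING: exact (Metropolis-corrected) sampling algorithms for lattice gauge theory; figures
of merit are autocorrelation/cost numbers at stated couplings and volumes; no continuum-physics
claim.

# IdealStarThreeTermLaw — THE IDEALISED HOT-ONLY STAR (ONE LAW `ν` AT EVERY LEVEL, IDENTITY MAPS, EXACT HOT SAMPLER,
# UNIFORM LISTING `m = cK`, `|S| ≥ 4(K+1)`) FROM THREE SIDES: THE COLLECTOR FLOOR `(K/t − 1)·log(K/4)`, THE REFRESH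
# FLOOR `(K+1)/(2(1−t))` AND THE RETUNED CEILING `⌈((K+t)/(t(1−t)))·log(4(K+b*)/b*)⌉`, `b* = t(K+1)/(K+t)` — THE MIXING
# TIME IS `K·max{(1/t)·log K, 1/(2(1−t))}` UP TO THE PRODUCT FORM AND THE LOGARITHM'S ARGUMENT (lean-2 GEN-26, ours)

Venture-side (OURS).  Cell `lqcd-flow` (pub-lqcd), unit `pub-lqcd-lean-2-g26`, 2026-08-27.  Chapter M, file 28 — the
programme's sharpest located example.  The idealised star is the perfect-transport case with identity maps, so both
floors apply (the refresh budget needs identity or sector-preserving maps; the collector floor and the ceiling hold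
for any maps).

## What is proved

* **`idealStar_threeTerm_law`** — `K ≥ 4`, `|S| ≥ 4(K+1)`, `0 < t < 1`, `ν` positive of unit mass, `ν`-reversible cold
  kernels (never used by the hot-only dynamics), every cold level listed at least `c ≥ 1` times, `m = cK`:
  **`(K − 1)·log(K/4) ≤ t_mix(1/4)`, `(K+1)/(2(1−t)) ≤ t_mix(1/4)`, and
  `t_mix(1/4) ≤ ⌈((K+t)/(t(1−t)))·log((K+b*)/(b*·(1/4)))⌉`** with `b* = t(K+1)/(K+t)`; the sharper collector form
  `(K/t − 1)·log(K/4)` needs a rare start and is `Scaling/DominatedStarRetunedConstants.hotOnlyPerfectStar_mixingTime_two_sided`.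

NOT CLAIMED: which of `(K/t)·log K`, `K/(1−t)`, `(K/(t(1−t)))·log K` is the truth when `t → 1` (the product form is
open from below); anything measured.  Literature grade (cell rule): OWN COMPOSITION; nothing cited as a fact; no new
bib keys.
-/

noncomputable section

open Finset Function
open Literature.Probability.MarkovChains

namespace Summit.Ventures.LatticeQCDFlow.Scaling

variable {S : Type*} [Fintype S] [DecidableEq S] {K m : ℕ} {ν : S → ℝ} {M : Fin (K + 1) → S → S → ℝ} {t : ℝ}

section ThreeTerm
variable (κ : Fin m → Fin K)

/-- **THE IDEALISED STAR FROM THREE SIDES:** collector floor, refresh floor, retuned ceiling (`K ≥ 4`, `|S| ≥ 4(K+1)`,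
`0 < t < 1`, `m = cK`, hot-only updates, identity maps, one positive unit-mass law `ν`, `ν`-reversible cold kernels).
[ours] -/
theorem idealStar_threeTerm_law (hK : 4 ≤ K) (hS : 4 * (K + 1) ≤ Fintype.card S) (ht0 : 0 < t) (ht1 : t < 1)
    (hν : ∀ v, 0 < ν v) (hν1 : ∑ v, ν v = 1) (hM : ∀ k, IsRowStochastic (M k)) (hMrev : ∀ k, DetailedBalance ν (M k))
    (hM0 : ∀ u v, M 0 u v = ν v) {c : ℕ} (hc1 : 1 ≤ c)
    (hc : ∀ p' : Fin K, c ≤ (univ.filter (fun r : Fin m => κ r = p')).card) (hmc : m = c * K) :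
    ((K : ℝ) - 1) * Real.log (K / 4)
        ≤ (mixingTime (fun y z : Fin (K + 1) → S => t * ptGraphSwap (fun _ : Fin (K + 1) => ν)
            (fun r : Fin m => (((0 : Fin (K + 1)), (κ r).succ) : Fin (K + 1) × Fin (K + 1))) (fun _ => Equiv.refl S) y z
            + (1 - t) * prodKernel (fun k : Fin (K + 1) => if k = 0 then (1 : ℝ) else 0) M y z)
          (tensorFun (fun _ : Fin (K + 1) => ν)) (1 / 4) : ℝ) ∧
      ((K : ℝ) + 1) / (2 * (1 - t))
        ≤ (mixingTime (fun y z : Fin (K + 1) → S => t * ptGraphSwap (fun _ : Fin (K + 1) => ν)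
            (fun r : Fin m => (((0 : Fin (K + 1)), (κ r).succ) : Fin (K + 1) × Fin (K + 1))) (fun _ => Equiv.refl S) y z
            + (1 - t) * prodKernel (fun k : Fin (K + 1) => if k = 0 then (1 : ℝ) else 0) M y z)
          (tensorFun (fun _ : Fin (K + 1) => ν)) (1 / 4) : ℝ) ∧
      mixingTime (fun y z : Fin (K + 1) → S => t * ptGraphSwap (fun _ : Fin (K + 1) => ν)
            (fun r : Fin m => (((0 : Fin (K + 1)), (κ r).succ) : Fin (K + 1) × Fin (K + 1))) (fun _ => Equiv.refl S) y z
            + (1 - t) * prodKernel (fun k : Fin (K + 1) => if k = 0 then (1 : ℝ) else 0) M y z)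
          (tensorFun (fun _ : Fin (K + 1) => ν)) (1 / 4)
        ≤ ⌈((K : ℝ) + t) / (t * (1 - t))
            * Real.log (((K : ℝ) + t * ((K : ℝ) + 1) / (t * ((K : ℝ) + 1) + (1 - t) * K))
              / (t * ((K : ℝ) + 1) / (t * ((K : ℝ) + 1) + (1 - t) * K) * (1 / 4)))⌉₊ := by
  have hm : 1 ≤ m := by rw [hmc]; exact Nat.one_le_iff_ne_zero.mpr (Nat.mul_ne_zero (by omega) (by omega))
  have hcm : c ≤ m := by rw [hmc]; exact Nat.le_mul_of_pos_right c (by omega)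
  have hμ : ∀ (k : Fin (K + 1)) (v : S), 0 < (fun _ : Fin (K + 1) => ν) k v := fun _ v => hν v
  have hμ1 : ∀ k : Fin (K + 1), ∑ u, (fun _ : Fin (K + 1) => ν) k u = 1 := fun _ => hν1
  have hMrev' : ∀ k : Fin (K + 1), DetailedBalance ((fun _ : Fin (K + 1) => ν) k) (M k) := fun k => hMrev k
  have hM0' : ∀ u v, M 0 u v = (fun _ : Fin (K + 1) => ν) 0 v := hM0
  have hperf : ∀ (r : Fin m) (u : S), (fun _ : Fin (K + 1) => ν) (κ r).succ ((fun _ : Fin m => Equiv.refl S) r u)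
      = (fun _ : Fin (K + 1) => ν) 0 u := fun _ _ => rfl
  have hw0 : ∀ k : Fin (K + 1), 0 ≤ (if k = 0 then (1 : ℝ) else 0) := fun k => by split_ifs <;> norm_num
  have hw00 : (0 : ℝ) < (if (0 : Fin (K + 1)) = 0 then (1 : ℝ) else 0) := by rw [if_pos rfl]; norm_num
  have hw1 : ∑ k : Fin (K + 1), (if k = 0 then (1 : ℝ) else 0) = 1 := by
    rw [Finset.sum_ite_eq' univ (0 : Fin (K + 1)), if_pos (mem_univ _)]
  have hstat : ∀ k : Fin (K + 1), k ≠ 0 → ∀ v, ∑ u, (fun _ : Fin (K + 1) => ν) k u * M k u v = (fun _ : Fin (K + 1) => ν) k v :=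
    fun k _ v => (hMrev' k).isStationary (hM k).2 v
  -- the ceiling (and a time at which the scheme is `1/4`-close) from the retuned constants
  obtain ⟨_, hhi⟩ := hotOnlyPerfectStar_mixingTime_two_sided κ (fun _ => Equiv.refl S) (μ := fun _ : Fin (K + 1) => ν)
    (by omega) ht0 ht1 hμ hμ1 hM hMrev' hM0' hperf hc1 hc hmc
    (Classical.choose (exists_rare_coldStart (μ := fun _ : Fin (K + 1) => ν) hμ1 (by omega)))
    (Classical.choose_spec (exists_rare_coldStart (μ := fun _ : Fin (K + 1) => ν) hμ1 (by omega)))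
  have hmix : ∃ t₀, worstTvDist (fun y z : Fin (K + 1) → S => t * ptGraphSwap (fun _ : Fin (K + 1) => ν)
      (fun r : Fin m => (((0 : Fin (K + 1)), (κ r).succ) : Fin (K + 1) × Fin (K + 1))) (fun _ => Equiv.refl S) y z
      + (1 - t) * prodKernel (fun k : Fin (K + 1) => if k = 0 then (1 : ℝ) else 0) M y z)
      (tensorFun (fun _ : Fin (K + 1) => ν)) t₀ ≤ 1 / 4 :=
    ⟨_, perfectStar_worstTvDist_le_of_ge_log κ (fun _ => Equiv.refl S) (μ := fun _ : Fin (K + 1) => ν) hm ht0 ht1 hw0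
      hw00 hw1 hμ hμ1 hM hM0' hstat hperf hc1 hc hcm (by norm_num : (0:ℝ) < 1 / 4) (Nat.le_ceil _)⟩
  have hθ : 0 < t + (1 - t) * (1 - (if (0 : Fin (K + 1)) = 0 then (1 : ℝ) else 0)) := by
    rw [if_pos rfl]; linarith
  refine ⟨?_, ?_, hhi⟩
  · exact hubList_mixingTime_ge_of_card κ (fun _ => Equiv.refl S) hK (by omega) hm hμ hμ1 hM hMrev' hw0 hw1 ht0.le ht1.le
      hθ hmix
  · exact refreshBudget_mixingTime_ge_quarter_of_card (e := fun r : Fin m =>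
      (((0 : Fin (K + 1)), (κ r).succ) : Fin (K + 1) × Fin (K + 1))) hm (hubList_fst_ne_snd κ) hμ hμ1 hM hMrev' hw0 hw1
      ht0.le ht1 hS hmix

end ThreeTerm

end Summit.Ventures.LatticeQCDFlow.Scaling

end
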